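import Mathlib
import HarnessLib
import Summits.Parity.GeneralizedHardyLittlewood.Theses.LeeYangFibres
import Summits.Parity.GeneralizedHardyLittlewood.Theorems.LeeYangFibresFibreHyperbolicityDefs
import Summits.Parity.GeneralizedHardyLittlewood.Theorems.LeeYangFibresHyperbolicityClipsParityNewton

/-!
# Crux `FibreHyperbolicity` (stmt-Parity-14108): what the crux says about PRIMES — prime-column log-concavity

A NECESSITY theorem for the crux `LeeYangFibres.FibreHyperbolicity` (line "model transfer", lead seat c1),
unconditional and sorry-free. Fix a coordinate `i` of a `t`-form system and call

  `P_m := C_{(m; 1, …, 1)} = #{n ∈ K ∩ ℤ : P⁻(ψ_i(n)) > N^{1/u}, Ω(ψ_i(n)) = m, and ψ_k(n) is a PRIME > N^{1/u} for every k ≠ i}`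

the PRIME COLUMN of the joint rough Ω-cell tensor (`jointCell` at the index `Function.update (fun _ => 1) i m`). We prove

* `fibre_const_eq` — with ALL frozen fugacities equal to `w`, the crux's fibre is the monomial sum
  `Σ_j (C_j w^{s(j)}) ζ^{j_i}`, `s(j) = Σ_{k ≠ i} j_k`;
* `primeColumn_logConcave_of_FHAt` — `FHAt t` (the crux at `t` forms) forces, for `N ≥ N₀` and every admissible
  `(Ψ, K)` (`‖Ψ‖_N ≤ L`, `K` convex in `[-N, N]`, `β_∞ 𝔖 ≥ ηN`), every `i` and every `1 ≤ m ≤ u - 2`,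
  `P_m · P_{m+2} ≤ P_{m+1}²`: Newton's inequality for the real-rooted fibre with non-negative coefficients
  (`HyperbolicityClipsParity.newton_filter_sum_sq`) sandwiched between its lowest `w`-layer — the prime column,
  weight `w^{t-1}` — and `w^t · (total count)`, then `w → 0⁺`;
* `primeColumn_logConcave_of_fibreHyperbolicity` — the same from the crux verbatim, for every `t ≥ 1`;
* `primeColumn_noInternalZero_of_FHAt` — in particular the prime column has no internal zeros
  (`P_m > 0 ∧ P_{m+2} > 0 → P_{m+1} > 0`).

Reading (`t = 2`, `Ψ = (n, n + 2)`, `i = 0`): the crux contains the log-concavity in `m` of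
`#{n ∈ K : n + 2 prime, P⁻(n) > N^{1/u}, Ω(n) = m}` — sign-sensitive information about shifted primes that no
sieve axiom supplies (Selberg/Bombieri parity), and that is not implied by the Hardy–Littlewood conjecture for
affine-linear systems either (the cells `m ≥ 2` count `p₁⋯p_m + 2 = prime`, a multilinear pattern). This is the formal
content of the line's finding "every proof of the crux must control the zero locus of a shifted-prime Ω-cell
polynomial", and a kill interface: a proved violation of prime-column log-concavity refutes the crux.
-/

noncomputable section

namespace Summit.Parity.GeneralizedHardyLittlewood.Cruxes.FibreHyperbolicity.ModelTransfer

open scoped BigOperators Classical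
open Finset
open Literature.NumberTheory.Sieve
open Summit.Parity.GeneralizedHardyLittlewood.Theses.LeeYangFibres (FibreHyperbolicity)
open Summit.Parity.GeneralizedHardyLittlewood.Theorems.HyperbolicityClipsParity (newton_filter_sum_sq)

/-! ## The fibre with equal frozen fugacities -/

/-- With all frozen fugacities equal to `w`, the crux's fibre in coordinate `i` is the monomial sum
`Σ_{j ∈ [1,u]^t} (C_j · w^{Σ_{k≠i} j_k}) ζ^{j_i}`. -/
theorem fibre_const_eq (t N u : ℕ) (Ψ : Fin t → AffLinForm 1) (K : Set (Fin 1 → ℝ)) (i : Fin t)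
    (w : ℝ) (ζ : ℂ) :
    fibre t N u Ψ K i (fun _ => w) ζ =
      ∑ j ∈ Fintype.piFinset (fun _ : Fin t => Finset.Icc 1 u),
        (((jointCell t N u Ψ K j : ℝ) * w ^ (∑ k ∈ Finset.univ.erase i, j k) : ℝ) : ℂ) * ζ ^ (j i) := by
  unfold fibre
  refine Finset.sum_congr rfl fun j _ => ?_
  rw [← Finset.mul_prod_erase Finset.univ _ (Finset.mem_univ i), if_pos rfl]
  have h : ∏ k ∈ Finset.univ.erase i, (if k = i then ζ else ((w : ℝ) : ℂ)) ^ j k =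
      ((w : ℝ) : ℂ) ^ (∑ k ∈ Finset.univ.erase i, j k) := by
    rw [← Finset.prod_pow_eq_pow_sum]
    exact Finset.prod_congr rfl fun k hk => by rw [if_neg (Finset.ne_of_mem_erase hk)]
  rw [h]
  push_cast
  ring

/-! ## The frozen exponent `s(j) = Σ_{k ≠ i} j_k` on the box `[1,u]^t` -/

/-- The column index `(m; 1, …, 1)` has frozen exponent `t - 1`. -/
theorem frozenExp_update {t : ℕ} (i : Fin t) (m : ℕ) :
    (∑ k ∈ Finset.univ.erase i, Function.update (fun _ : Fin t => (1 : ℕ)) i m k) = t - 1 := by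
  rw [Finset.sum_congr rfl fun k hk => Function.update_of_ne (Finset.ne_of_mem_erase hk) _ _]
  simp [Finset.card_erase_of_mem (Finset.mem_univ i)]

/-- The column index `(m; 1, …, 1)` lies in the box `[1,u]^t` when `1 ≤ m ≤ u` (and `1 ≤ u`). -/
theorem update_mem_box {t u : ℕ} (i : Fin t) {m : ℕ} (hm : 1 ≤ m) (hmu : m ≤ u) :
    Function.update (fun _ : Fin t => (1 : ℕ)) i m ∈ Fintype.piFinset (fun _ : Fin t => Finset.Icc 1 u) := by
  rw [Fintype.mem_piFinset]
  intro k
  by_cases hk : k = i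
  · subst hk; rw [Function.update_self]; exact Finset.mem_Icc.mpr ⟨hm, hmu⟩
  · rw [Function.update_of_ne hk]; exact Finset.mem_Icc.mpr ⟨le_rfl, le_trans hm hmu⟩

/-- Off the column, the frozen exponent is at least `t`: if `j ∈ [1,u]^t` has `j_i = m` but `j ≠ (m; 1, …, 1)`, some
other coordinate is `≥ 2`. -/
theorem le_frozenExp_of_ne {t u : ℕ} (i : Fin t) {m : ℕ} {j : Fin t → ℕ}
    (hj : j ∈ Fintype.piFinset (fun _ : Fin t => Finset.Icc 1 u)) (hji : j i = m)
    (hne : j ≠ Function.update (fun _ : Fin t => (1 : ℕ)) i m) :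
    t ≤ ∑ k ∈ Finset.univ.erase i, j k := by
  have hj1 : ∀ k, 1 ≤ j k := fun k => (Finset.mem_Icc.mp (Fintype.mem_piFinset.mp hj k)).1
  -- a coordinate `k₀ ≠ i` with `j k₀ ≠ 1`
  obtain ⟨k₀, hk₀i, hk₀⟩ : ∃ k₀, k₀ ≠ i ∧ j k₀ ≠ 1 := by
    by_contra hall
    push Not at hall
    apply hne
    funext k
    by_cases hk : k = i
    · subst hk; rw [Function.update_self]; exact hji
    · rw [Function.update_of_ne hk]; exact hall k hk
  have hk₀mem : k₀ ∈ Finset.univ.erase i := Finset.mem_erase.mpr ⟨hk₀i, Finset.mem_univ _⟩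
  have h2 : 2 ≤ j k₀ := by have := hj1 k₀; omega
  rw [← Finset.add_sum_erase _ _ hk₀mem]
  have hrest : ((Finset.univ.erase i).erase k₀).card ≤ ∑ k ∈ (Finset.univ.erase i).erase k₀, j k := by
    calc ((Finset.univ.erase i).erase k₀).card = ∑ _k ∈ (Finset.univ.erase i).erase k₀, 1 := by simp
      _ ≤ ∑ k ∈ (Finset.univ.erase i).erase k₀, j k := Finset.sum_le_sum fun k _ => hj1 k
  have hcard : ((Finset.univ.erase i).erase k₀).card = t - 2 := by
    rw [Finset.card_erase_of_mem hk₀mem, Finset.card_erase_of_mem (Finset.mem_univ i), Finset.card_univ,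
      Fintype.card_fin]
    omega
  have ht : 2 ≤ t := by
    have h := Finset.card_le_card (Finset.subset_univ ({i, k₀} : Finset (Fin t)))
    rw [Finset.card_univ, Fintype.card_fin, Finset.card_pair (Ne.symm hk₀i)] at h
    exact h
  omega

/-! ## The sandwich of a fibre coefficient between its prime-column layer and `w^t · total` -/

/-- The `m`-th coefficient of the equal-fugacity fibre, `p_m(w) = Σ_{j_i = m} C_j w^{s(j)}` (abstract non-negative
cell data `C`), satisfies `P_m w^{t-1} ≤ p_m(w) ≤ P_m w^{t-1} + w^t B` for `0 ≤ w ≤ 1`, `B = Σ_j C_j`, `1 ≤ m ≤ u`,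
`P_m = C_{(m;1,…,1)}`. -/
theorem coeff_sandwich {t u : ℕ} (i : Fin t) (C : (Fin t → ℕ) → ℝ) (hC : ∀ j, 0 ≤ C j) {m : ℕ}
    (hm : 1 ≤ m) (hmu : m ≤ u) {w : ℝ} (hw0 : 0 ≤ w) (hw1 : w ≤ 1) :
    C (Function.update (fun _ => 1) i m) * w ^ (t - 1) ≤
        ∑ j ∈ (Fintype.piFinset (fun _ : Fin t => Finset.Icc 1 u)).filter (fun j => j i = m),
          C j * w ^ (∑ k ∈ Finset.univ.erase i, j k) ∧
      ∑ j ∈ (Fintype.piFinset (fun _ : Fin t => Finset.Icc 1 u)).filter (fun j => j i = m),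
          C j * w ^ (∑ k ∈ Finset.univ.erase i, j k) ≤
        C (Function.update (fun _ => 1) i m) * w ^ (t - 1) +
          w ^ t * ∑ j ∈ Fintype.piFinset (fun _ : Fin t => Finset.Icc 1 u), C j := by
  have hemem : Function.update (fun _ : Fin t => (1 : ℕ)) i m ∈
      (Fintype.piFinset (fun _ : Fin t => Finset.Icc 1 u)).filter (fun j => j i = m) :=
    Finset.mem_filter.mpr ⟨update_mem_box i hm hmu, by rw [Function.update_self]⟩
  have hf0 : ∀ j : Fin t → ℕ, 0 ≤ C j * w ^ (∑ k ∈ Finset.univ.erase i, j k) :=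
    fun j => mul_nonneg (hC j) (pow_nonneg hw0 _)
  have hsplit := Finset.add_sum_erase
    ((Fintype.piFinset (fun _ : Fin t => Finset.Icc 1 u)).filter (fun j => j i = m))
    (fun j => C j * w ^ (∑ k ∈ Finset.univ.erase i, j k)) hemem
  beta_reduce at hsplit
  rw [frozenExp_update] at hsplit
  constructor
  · rw [← hsplit]
    exact le_add_of_nonneg_right (Finset.sum_nonneg fun j _ => hf0 j)
  · rw [← hsplit]
    refine add_le_add le_rfl ?_
    calc ∑ j ∈ ((Fintype.piFinset (fun _ : Fin t => Finset.Icc 1 u)).filter (fun j => j i = m)).erase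
            (Function.update (fun _ => 1) i m), C j * w ^ (∑ k ∈ Finset.univ.erase i, j k)
        ≤ ∑ j ∈ ((Fintype.piFinset (fun _ : Fin t => Finset.Icc 1 u)).filter (fun j => j i = m)).erase
            (Function.update (fun _ => 1) i m), w ^ t * C j := by
          refine Finset.sum_le_sum fun j hj => ?_
          obtain ⟨hjne, hjmem⟩ := Finset.mem_erase.mp hj
          obtain ⟨hjbox, hji⟩ := Finset.mem_filter.mp hjmem
          have hs : t ≤ ∑ k ∈ Finset.univ.erase i, j k := le_frozenExp_of_ne i hjbox hji hjne
          rw [mul_comm (w ^ t) (C j)]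
          exact mul_le_mul_of_nonneg_left (pow_le_pow_of_le_one hw0 hw1 hs) (hC j)
      _ ≤ ∑ j ∈ Fintype.piFinset (fun _ : Fin t => Finset.Icc 1 u), w ^ t * C j := by
          refine Finset.sum_le_sum_of_subset_of_nonneg
            ((Finset.erase_subset _ _).trans (Finset.filter_subset _ _)) fun j _ _ => ?_
          exact mul_nonneg (pow_nonneg hw0 _) (hC j)
      _ = w ^ t * ∑ j ∈ Fintype.piFinset (fun _ : Fin t => Finset.Icc 1 u), C j := by
          rw [Finset.mul_sum]

/-- Elementary limit: if `a ≤ (c + w B)²` for every `0 < w ≤ 1`, with `B, c ≥ 0`, then `a ≤ c²`. -/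
theorem le_sq_of_forall_le_sq_add {a c B : ℝ} (hc : 0 ≤ c) (hB : 0 ≤ B)
    (h : ∀ w : ℝ, 0 < w → w ≤ 1 → a ≤ (c + w * B) ^ 2) : a ≤ c ^ 2 := by
  refine le_of_forall_pos_le_add fun δ hδ => ?_
  set D : ℝ := 2 * c * B + B ^ 2 + 1 with hD
  have hDpos : 0 < D := by positivity
  set w : ℝ := min 1 (δ / D) with hw
  have hw0 : 0 < w := lt_min one_pos (div_pos hδ hDpos)
  have hw1 : w ≤ 1 := min_le_left _ _
  have hwD : w * D ≤ δ := by
    have : w ≤ δ / D := min_le_right _ _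
    rwa [le_div_iff₀ hDpos] at this
  calc a ≤ (c + w * B) ^ 2 := h w hw0 hw1
    _ = c ^ 2 + w * (2 * c * B + w * B ^ 2) := by ring
    _ ≤ c ^ 2 + w * D := by
        refine add_le_add le_rfl (mul_le_mul_of_nonneg_left ?_ hw0.le)
        rw [hD]
        nlinarith [mul_le_of_le_one_left (sq_nonneg B) hw1]
    _ ≤ c ^ 2 + δ := add_le_add le_rfl hwD

/-! ## Prime-column log-concavity -/

/-- **The crux at `t` forms forces log-concavity of every prime column.** If `FHAt t` holds then, with its own
`u ≥ max(u₀, 2)` and `N₀`: for `N ≥ N₀`, every admissible `(Ψ, K)` with `β_∞ 𝔖 ≥ ηN`, every coordinate `i` and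
every `1 ≤ m ≤ u - 2`,
`C_{(m;1,…,1)} · C_{(m+2;1,…,1)} ≤ C_{(m+1;1,…,1)}²`, where `C_{(m;1,…,1)}` counts the `n ∈ K ∩ ℤ` with
`Ω(ψ_i(n)) = m`, `ψ_i(n)` `N^{1/u}`-rough and `ψ_k(n)` PRIME (`> N^{1/u}`) for all `k ≠ i`.
Proof: Newton's inequality for the equal-fugacity fibre (real-rooted by `FHAt t`, non-negative coefficients),
whose `m`-th coefficient is `w^{t-1} C_{(m;1,…,1)} + O(w^t)`; divide by `w^{2(t-1)}` and let `w → 0⁺`. -/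
theorem primeColumn_logConcave_of_FHAt {t : ℕ} (hF : FHAt t) :
    ∀ (L u₀ : ℕ) (η : ℝ), 0 < η → ∃ u : ℕ, u₀ ≤ u ∧ 2 ≤ u ∧ ∃ N₀ : ℕ, ∀ N : ℕ, N₀ ≤ N →
      ∀ Ψ : Fin t → AffLinForm 1, IsNondegenerateSystem Ψ → affLinSize Ψ N ≤ L →
      ∀ K : Set (Fin 1 → ℝ), Convex ℝ K → K ⊆ realBox 1 N →
      η * (N : ℝ) ≤ archFactor Ψ K * singularProduct Ψ →
      ∀ i : Fin t, ∀ m : ℕ, 1 ≤ m → m + 2 ≤ u →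
        (jointCell t N u Ψ K (Function.update (fun _ => 1) i m) : ℝ) *
            jointCell t N u Ψ K (Function.update (fun _ => 1) i (m + 2)) ≤
          (jointCell t N u Ψ K (Function.update (fun _ => 1) i (m + 1)) : ℝ) ^ 2 := by
  intro L u₀ η hη
  obtain ⟨u, hu₀, hu2, N₀, hN₀⟩ := hF L u₀ η hη
  refine ⟨u, hu₀, hu2, N₀, fun N hN Ψ hΨ hsize K hK hKN hmass i m hm hmu => ?_⟩
  set box := Fintype.piFinset (fun _ : Fin t => Finset.Icc 1 u) with hbox
  set C : (Fin t → ℕ) → ℝ := fun j => (jointCell t N u Ψ K j : ℝ) with hC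
  set s : (Fin t → ℕ) → ℕ := fun j => ∑ k ∈ Finset.univ.erase i, j k with hs
  set B : ℝ := ∑ j ∈ box, C j with hB
  have hB0 : 0 ≤ B := Finset.sum_nonneg fun j _ => Nat.cast_nonneg _
  set col : ℕ → ℝ := fun n => C (Function.update (fun _ => 1) i n) with hcol
  have hcol0 : ∀ n, 0 ≤ col n := fun n => Nat.cast_nonneg _
  -- Newton's inequality for the equal-fugacity fibre, `0 < w ≤ 1`
  have hnewton : ∀ w : ℝ, 0 < w → w ≤ 1 →
      (∑ j ∈ box.filter (fun j => j i = m), C j * w ^ s j) *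
          (∑ j ∈ box.filter (fun j => j i = m + 2), C j * w ^ s j) ≤
        (∑ j ∈ box.filter (fun j => j i = m + 1), C j * w ^ s j) ^ 2 := by
    intro w hw0 hw1
    refine newton_filter_sum_sq box (fun j => C j * w ^ s j) (fun j => j i)
      (fun j _ => mul_nonneg (Nat.cast_nonneg _) (pow_nonneg hw0.le _)) ?_ m
    intro z hz
    refine hN₀ N hN Ψ hΨ hsize K hK hKN hmass i (fun _ => w) (fun _ => ⟨hw0, hw1⟩) z ?_
    rw [fibre_const_eq, ← hz]
  -- the sandwich, divided by `w^{2(t-1)}`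
  have hkey : ∀ w : ℝ, 0 < w → w ≤ 1 → col m * col (m + 2) ≤ (col (m + 1) + w * B) ^ 2 := by
    intro w hw0 hw1
    have hwt : 0 < w ^ (t - 1) := pow_pos hw0 _
    have hC0 : ∀ j, 0 ≤ C j := fun j => Nat.cast_nonneg _
    obtain ⟨hlo_m, -⟩ := coeff_sandwich (u := u) i C hC0 hm (by omega : m ≤ u) hw0.le hw1
    obtain ⟨hlo_m2, -⟩ := coeff_sandwich (u := u) i C hC0 (by omega : 1 ≤ m + 2) hmu hw0.le hw1
    obtain ⟨-, hup_m1⟩ :=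
      coeff_sandwich (u := u) i C hC0 (by omega : 1 ≤ m + 1) (by omega : m + 1 ≤ u) hw0.le hw1
    have h1 : (col m * w ^ (t - 1)) * (col (m + 2) * w ^ (t - 1)) ≤
        (col (m + 1) * w ^ (t - 1) + w ^ t * B) ^ 2 :=
      calc (col m * w ^ (t - 1)) * (col (m + 2) * w ^ (t - 1))
          ≤ (∑ j ∈ box.filter (fun j => j i = m), C j * w ^ s j) *
              (∑ j ∈ box.filter (fun j => j i = m + 2), C j * w ^ s j) :=
            mul_le_mul hlo_m hlo_m2 (by positivity) (le_trans (by positivity) hlo_m)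
        _ ≤ (∑ j ∈ box.filter (fun j => j i = m + 1), C j * w ^ s j) ^ 2 := hnewton w hw0 hw1
        _ ≤ (col (m + 1) * w ^ (t - 1) + w ^ t * B) ^ 2 := by
            have h0 : 0 ≤ ∑ j ∈ box.filter (fun j => j i = m + 1), C j * w ^ s j :=
              Finset.sum_nonneg fun j _ => mul_nonneg (Nat.cast_nonneg _) (pow_nonneg hw0.le _)
            exact pow_le_pow_left₀ h0 hup_m1 2
    have h2 : (col (m + 1) * w ^ (t - 1) + w ^ t * B) ^ 2 =
        (w ^ (t - 1)) ^ 2 * (col (m + 1) + w * B) ^ 2 := by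
      have : w ^ t = w ^ (t - 1) * w := by
        rcases Nat.eq_zero_or_pos t with ht | ht
        · subst ht
          exact absurd i.isLt (Nat.not_lt_zero _)
        · rw [← pow_succ, Nat.sub_add_cancel ht]
      rw [this]; ring
    have h3 : (w ^ (t - 1)) ^ 2 * (col m * col (m + 2)) ≤ (w ^ (t - 1)) ^ 2 * (col (m + 1) + w * B) ^ 2 := by
      calc (w ^ (t - 1)) ^ 2 * (col m * col (m + 2))
          = (col m * w ^ (t - 1)) * (col (m + 2) * w ^ (t - 1)) := by ring
        _ ≤ (col (m + 1) * w ^ (t - 1) + w ^ t * B) ^ 2 := h1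
        _ = (w ^ (t - 1)) ^ 2 * (col (m + 1) + w * B) ^ 2 := h2
    exact le_of_mul_le_mul_left h3 (pow_pos hwt 2)
  exact le_sq_of_forall_le_sq_add (hcol0 _) hB0 hkey

/-- **The crux forces prime-column log-concavity at every `t ≥ 1`** (the previous theorem, fed with the crux
verbatim through `crux_iff`). For `t = 2`, `Ψ = (n, n + 2)`, `i = 0` this is the log-concavity in `m` of
`#{n ∈ K : n + 2 prime > N^{1/u}, P⁻(n) > N^{1/u}, Ω(n) = m}` for all large `N` — parity-sensitive information about
shifted primes. -/
theorem primeColumn_logConcave_of_fibreHyperbolicity :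
    FibreHyperbolicity → ∀ t : ℕ, 1 ≤ t → ∀ (L u₀ : ℕ) (η : ℝ), 0 < η → ∃ u : ℕ, u₀ ≤ u ∧ 2 ≤ u ∧ ∃ N₀ : ℕ,
      ∀ N : ℕ, N₀ ≤ N → ∀ Ψ : Fin t → AffLinForm 1, IsNondegenerateSystem Ψ → affLinSize Ψ N ≤ L →
      ∀ K : Set (Fin 1 → ℝ), Convex ℝ K → K ⊆ realBox 1 N →
      η * (N : ℝ) ≤ archFactor Ψ K * singularProduct Ψ → ∀ i : Fin t, ∀ m : ℕ, 1 ≤ m → m + 2 ≤ u →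
        (jointCell t N u Ψ K (Function.update (fun _ => 1) i m) : ℝ) *
            jointCell t N u Ψ K (Function.update (fun _ => 1) i (m + 2)) ≤
          (jointCell t N u Ψ K (Function.update (fun _ => 1) i (m + 1)) : ℝ) ^ 2 :=
  fun hF t ht => primeColumn_logConcave_of_FHAt (crux_iff.mp hF t ht)

/-- **No internal zeros in a prime column.** Under `FHAt t` (same `u`, `N₀`): if the prime column has entries at
`m` and `m + 2`, it has one at `m + 1` — e.g. (`Ψ = (n, n+2)`) if `K` contains an `n` with `n + 2` prime and
`Ω(n) = 1` (a twin prime) and one with `n + 2` prime and `Ω(n) = 3`, it contains one with `n + 2` prime and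
`Ω(n) = 2` (all prime factors `> N^{1/u}`). -/
theorem primeColumn_noInternalZero_of_FHAt {t : ℕ} (hF : FHAt t) :
    ∀ (L u₀ : ℕ) (η : ℝ), 0 < η → ∃ u : ℕ, u₀ ≤ u ∧ 2 ≤ u ∧ ∃ N₀ : ℕ, ∀ N : ℕ, N₀ ≤ N →
      ∀ Ψ : Fin t → AffLinForm 1, IsNondegenerateSystem Ψ → affLinSize Ψ N ≤ L →
      ∀ K : Set (Fin 1 → ℝ), Convex ℝ K → K ⊆ realBox 1 N →
      η * (N : ℝ) ≤ archFactor Ψ K * singularProduct Ψ →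
      ∀ i : Fin t, ∀ m : ℕ, 1 ≤ m → m + 2 ≤ u →
        0 < jointCell t N u Ψ K (Function.update (fun _ => 1) i m) →
        0 < jointCell t N u Ψ K (Function.update (fun _ => 1) i (m + 2)) →
        0 < jointCell t N u Ψ K (Function.update (fun _ => 1) i (m + 1)) := by
  intro L u₀ η hη
  obtain ⟨u, hu₀, hu2, N₀, hN₀⟩ := primeColumn_logConcave_of_FHAt hF L u₀ η hη
  refine ⟨u, hu₀, hu2, N₀, fun N hN Ψ hΨ hsize K hK hKN hmass i m hm hmu h0 h2 => ?_⟩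
  have h := hN₀ N hN Ψ hΨ hsize K hK hKN hmass i m hm hmu
  have hpos : (0 : ℝ) < (jointCell t N u Ψ K (Function.update (fun _ => 1) i m) : ℝ) *
      jointCell t N u Ψ K (Function.update (fun _ => 1) i (m + 2)) :=
    mul_pos (by exact_mod_cast h0) (by exact_mod_cast h2)
  have hsq : (0 : ℝ) < (jointCell t N u Ψ K (Function.update (fun _ => 1) i (m + 1)) : ℝ) ^ 2 :=
    lt_of_lt_of_le hpos h
  have : (0 : ℝ) < (jointCell t N u Ψ K (Function.update (fun _ => 1) i (m + 1)) : ℝ) := by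
    rcases (Nat.cast_nonneg (α := ℝ) (jointCell t N u Ψ K (Function.update (fun _ => 1) i (m + 1)))).lt_or_eq
      with hlt | heq
    · exact hlt
    · rw [← heq] at hsq; simp at hsq
  exact_mod_cast this

end Summit.Parity.GeneralizedHardyLittlewood.Cruxes.FibreHyperbolicity.ModelTransfer

end
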